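import Summits.CriticalPhenomena.PercolationContinuityZ3.Theorems.FK.SelfDualPointNonPercolation
import Summits.CriticalPhenomena.PercolationContinuityZ3.Theorems.FK.UniquenessNearOneRegularity
import HarnessLib

/-!
# Zhang's argument on `ℤ²`, VII: no first-order transition away from the self-dual point
# (Grimmett 2006, Thm. (6.17)(b) with Thm. (4.63), Prop. (4.28), Thm. (5.16))

Claimed R42 (8)(c) in the cell INBOX at 2026-08-27T21:44:50Z by fkp-10a gen 351 (NEW CLAIM #2 of the gen), addressed to coordinator fk-4 g261 (seated 19:52Z 2026-08-27; R142 l.8183, (κ) word l.8194: «anything further = a NEW R42 (8)(c) claim, R143»); lineage row FO-10a-g351r (self-suggested), package g351-regularity, label RG-A.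
Support file of the `fk-continuity` cell (lineage fkp-10a, `--supports stmt-CriticalPhenomena-4575`); builds on
p205010 (kernel theorem, internal audit signed; external expert review pending).  No definitions, no named facts,
no sorries; standard axioms.  `d = 2`, `q ≥ 1`.

By Thm. (6.17)(b) (`rcLimit_false_eq_rcLimit_true_of_ne_selfDual'`, `SelfDualPointNonPercolation.lean`) the free and
wired random-cluster measures of `ℤ²` agree at every `p ≠ p_sd(q) = √q/(1+√q)`; the lineage's uniqueness ⇔
regularity dictionary (Thm. (4.63): `EdgeDensityContinuityCriterion`, `PressureUniquenessCriterion`; Prop. (4.28):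
`LocalWeakOneSidedLimits`; Thm. (5.16): `ThetaInterlacing`) turns this into REGULARITY OF THE MODEL OFF `p_sd(q)`:
for every `p ∈ (0,1)` with `p ≠ p_sd(q)`
* `continuousAt_edgeDensity_of_ne_selfDual` — both edge densities `x ↦ h⁰(x,q)(e)`, `x ↦ h¹(x,q)(e)` are continuous at
  `p` (no latent heat);
* `differentiableAt_pressure_of_ne_selfDual` — the free pressure is differentiable at `p`;
* `isLocalEvent_continuousAt_of_ne_selfDual` — `x ↦ φ⁰_{x,q}(A)` and `x ↦ φ¹_{x,q}(A)` are continuous at `p` for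
  every local event `A` (weak continuity of `p ↦ φ^b_{p,q}`);
* `continuousWithinAt_Ioi_thetaFree_of_ne_selfDual` — `θ⁰(·,q)` is right-continuous at `p` (it is always
  left-continuous... precisely: `θ⁰(p+) = θ¹(p) = θ⁰(p)`).
So on `ℤ²` the only possible point of first-order phase transition of the random-cluster model with `q ≥ 1` is
`p_sd(q)` (where, for large `q`, the transition IS of first order — Thm. (6.35), not treated here).

## References

* G. Grimmett, *The Random-Cluster Model*, Springer 2006, §6.2 Thm. (6.17)(b); Thm. (4.63), Prop. (4.28),
  Thm. (5.16); §6.4 Thm. (6.35). [Grimmett2006]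
* G. Grimmett, *Percolation*, 2nd ed., Springer 1999, §11.3. [GrimmettPercolation1999]
-/

noncomputable section

open scoped Classical Topology
open MeasureTheory Filter Set

namespace Summit.CriticalPhenomena.PercolationContinuityZ3.Theorems.FK

open Literature.Probability.Percolation Literature.Probability.LatticeModels
  Literature.Barriers.CriticalPhenomena

variable {p q : ℝ}

/-- **No latent heat off the self-dual point**: for `0 < p < 1`, `p ≠ p_sd(q)`, `q ≥ 1` and every lattice edge `e` of
`ℤ²`, the free and wired edge densities `x ↦ h⁰(x,q)(e)`, `x ↦ h¹(x,q)(e)` are continuous at `p`.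
[cite: Grimmett2006, §6.2 Thm. (6.17)(b) with Thm. (4.63)] -/
theorem continuousAt_edgeDensity_of_ne_selfDual (hp : p ∈ Set.Ioo (0 : ℝ) 1) (hq : 1 ≤ q)
    (hne : p ≠ Real.sqrt q / (1 + Real.sqrt q)) {e : Sym2 (Site 2)} (he : e ∈ (zdGraph 2).edgeSet) :
    ContinuousAt (fun x : ℝ => freeEdgeDensity 2 x q e) p ∧ ContinuousAt (fun x : ℝ => wiredEdgeDensity 2 x q e) p := by
  have heq := rcLimit_false_eq_rcLimit_true_of_ne_selfDual' ⟨hp.1.le, hp.2.le⟩ hq hne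
  exact ⟨(rcLimit_false_eq_rcLimit_true_iff_continuousAt_freeEdgeDensity hp hq he).1 heq,
    (rcLimit_false_eq_rcLimit_true_iff_continuousAt_wiredEdgeDensity hp hq he).1 heq⟩

/-- **The pressure is differentiable off the self-dual point**: for `0 < p < 1`, `p ≠ p_sd(q)`, `q ≥ 1`, any function
`Φ` which is the per-site free pressure of `ℤ²` on `(0,1)` (`|Λ_N|⁻¹ log Z⁰_{Λ_N}(x,q) → Φ(x)`) is differentiable at `p`.
[cite: Grimmett2006, §6.2 Thm. (6.17)(b) with Thm. (4.63)] -/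
theorem differentiableAt_pressure_of_ne_selfDual (hp : p ∈ Set.Ioo (0 : ℝ) 1) (hq : 1 ≤ q)
    (hne : p ≠ Real.sqrt q / (1 + Real.sqrt q)) {Φ : ℝ → ℝ}
    (hΦ : ∀ x ∈ Set.Ioo (0 : ℝ) 1, Tendsto (fun N : ℕ =>
      Real.log (rcPartitionFunction (finsetGraph (zdGraph 2) (box 2 N)) x q (boxBC 2 false N)) /
        (Finset.card (box 2 N) : ℝ)) atTop (𝓝 (Φ x))) :
    DifferentiableAt ℝ Φ p :=
  (differentiableAt_pressure_iff_rcLimit_eq' (by norm_num) hp hq hΦ).2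
    (rcLimit_false_eq_rcLimit_true_of_ne_selfDual' ⟨hp.1.le, hp.2.le⟩ hq hne)

/-- **`p ↦ φ^b_{p,q}` is weakly continuous off the self-dual point**: for `0 < p < 1`, `p ≠ p_sd(q)`, `q ≥ 1` and every
local event `A`, both `x ↦ φ⁰_{x,q}(A)` and `x ↦ φ¹_{x,q}(A)` are continuous at `p`.
[cite: Grimmett2006, §6.2 Thm. (6.17)(b) with Prop. (4.28) and Thm. (4.63)] -/
theorem isLocalEvent_continuousAt_of_ne_selfDual (hp : p ∈ Set.Ioo (0 : ℝ) 1) (hq : 1 ≤ q)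
    (hne : p ≠ Real.sqrt q / (1 + Real.sqrt q)) {A : Set (BondConfig (Site 2))} (hA : IsLocalEvent A) :
    ContinuousAt (fun t : ℝ => (rcLimit 2 false t q).real A) p ∧
      ContinuousAt (fun t : ℝ => (rcLimit 2 true t q).real A) p := by
  have heq := rcLimit_false_eq_rcLimit_true_of_ne_selfDual' ⟨hp.1.le, hp.2.le⟩ hq hne
  exact ⟨(rcLimit_false_eq_rcLimit_true_iff_forall_isLocalEvent_continuousAt (by norm_num) hp hq).1 heq A hA,
    (rcLimit_false_eq_rcLimit_true_iff_forall_isLocalEvent_continuousAt_true (by norm_num) hp hq).1 heq A hA⟩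

/-- **`θ⁰(·,q)` is right-continuous off the self-dual point**: for `0 ≤ p < 1`, `p ≠ p_sd(q)`, `q ≥ 1`,
`x ↦ θ⁰(x,q)` is continuous from the right at `p` (`θ⁰(p+) = θ¹(p)` always, and `θ¹(p) = θ⁰(p)` off `p_sd(q)`).
[cite: Grimmett2006, §6.2 Thm. (6.17)(b) with Thm. (5.16)] -/
theorem continuousWithinAt_Ioi_thetaFree_of_ne_selfDual (hp : p ∈ Set.Ico (0 : ℝ) 1) (hq : 1 ≤ q)
    (hne : p ≠ Real.sqrt q / (1 + Real.sqrt q)) :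
    ContinuousWithinAt (fun x : ℝ => thetaFree 2 x q) (Set.Ioi p) p :=
  (continuousWithinAt_Ioi_thetaFree_iff hq hp).2
    (thetaFree_eq_thetaWired_of_ne_selfDual' ⟨hp.1, hp.2.le⟩ hq hne)

/-- **Below the self-dual point `θ⁰(·,q)` and `θ¹(·,q)` vanish identically**: for `0 ≤ p` and every
`x ∈ [p, p_sd(q))`, `θ¹(x,q) = θ⁰(x,q) = 0` (`q ≥ 1`; in particular both are constant, hence continuous, on
`[0, p_sd(q))`). [cite: Grimmett2006, §6.2 Thm. (6.17)(a)] -/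
theorem thetaWired_eq_zero_eventually_of_lt_selfDual (hq : 1 ≤ q) (hp0 : 0 ≤ p) :
    ∀ x ∈ Set.Ico p (Real.sqrt q / (1 + Real.sqrt q)), thetaWired 2 x q = 0 ∧ thetaFree 2 x q = 0 := by
  intro x hx
  have hx0 : 0 ≤ x := hp0.trans hx.1
  exact ⟨thetaWired_eq_zero_of_lt_selfDual hq hx0 hx.2, thetaFree_eq_zero_of_le_selfDual hq hx0 hx.2.le⟩

end Summit.CriticalPhenomena.PercolationContinuityZ3.Theorems.FK

end
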